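import Mathlib.Algebra.Group.Pi.Lemmas
import Literature.AlgebraicGeometry.Frobenioids.RlfStructure
import HarnessLib

/-!
# Frobenioids I, Def. 2.4 (i)/(ii): the `ℝ_{≥0}`-powers on `N ⊗ ℝ_{≥0}`, on `M^rlf_factor` and on `M^rlf`

Mochizuki, *The geometry of Frobenioids I*, Kyushu J. Math. **62** (2008), §0 p. 10 ("`M ⊗ ℝ_{≥0}`")
and §2, Definition 2.4 (i) p. 48 ("`(M^rlf)^gp ⊆ (M^rlf_factor)^gp` [is] an `ℝ`-vector space [spanned by
`M^rlf`]"), (ii) p. 48 ("Note that if `Λ` supports `M`, then `Λ_{>0}` acts naturally on `M`")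
[cite: MochizukiFrdI2008, Def. 2.4(i) p.48] [cite: MochizukiFrdI2008, Def. 2.4(ii) p.48].

The tree renders `N ⊗ ℝ_{≥0}` as the double dual `Hom(Hom(N, ℝ_{≥0}), ℝ_{≥0})` (`MonoidRealification.lean`,
seat abc-iut-L1-t2) and `M^rlf ⊆ M^rlf_factor = ∏_𝔮 M^pf_𝔮 ⊗ ℝ_{≥0}` (`PerfFactorial.lean`).  On these the
`ℝ_{≥0}`-"scalar" structure that print uses tacitly (the `ℝ`-vector space `(M^rlf)^gp`, the monoids
`ℝ · Φ^birat ⊆ (Φ^rlf)^gp` of Prop. 5.3, `ℝ_{>0}` acting when `ℝ` supports `M`) is CANONICAL and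
choice-free: the power `s ↦ s^r` (`r ∈ ℝ_{≥0}`) multiplies every value of `s : Hom(N^∨, ℝ_{≥0})` by `r`.
This file constructs it and proves its laws:

* `Realification.rpow r : N ⊗ ℝ_{≥0} →* N ⊗ ℝ_{≥0}` with `rpow_zero/one/add/mul/natCast`, `root = rpow (1/n)`,
  functoriality `map_rpow`, injectivity and order properties (`rpow_dvd_rpow_iff`, monotone in `r`),
  and the pointwise description of the order `Realification.dvd_iff_apply_le`;
* `RlfFactor.rpow r` (componentwise) with `supp (a^r) = supp a` for `r ≠ 0`;
* `IsPerfFactorial.Rlf.rpow h r : M^rlf →* M^rlf` — `M^rlf` is stable since supports are preserved —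
  with the same laws; this is the `ℝ_{≥0}`-semimodule structure whose groupification is the printed
  `ℝ`-vector space `(M^rlf)^gp` (file `RlfRealVectorSpace.lean`).

Multiplicative notation as in `Monoids.lean` (`s^r` is `r • s` of the additive picture).  No statement of
the paper is strengthened; everything here is a construction/verification inside Def. 2.4.
Seat abc-iut-L1-d2 (cell abc-iut), row «FrdI:Def2.4(ii)-ℝ-action + I3-MERGE» (L1-lead R45 (4)).
-/

noncomputable section

namespace Literature.AlgebraicGeometry.Frobenioids

open Function

universe u

/-! ### The order of `N ⊗ ℝ_{≥0}` is the pointwise order -/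

section RealificationOrder

variable {N : Type u} [CommMonoid N]

/-- In `N ⊗ ℝ_{≥0} = Hom(N^∨, ℝ_{≥0})`, if `s(f) ≤ s'(f)` for all `f` then `s ∣ s'` (the quotient `s'/s`,
taken valuewise, is again a homomorphism).  Converse of `Realification.apply_le_of_dvd`.
[cite: MochizukiFrdI2008, §0 p.10] -/
theorem Realification.dvd_of_apply_le {s s' : Realification N}
    (h : ∀ f, Multiplicative.toAdd (s.toHom f) ≤ Multiplicative.toAdd (s'.toHom f)) : s ∣ s' := by
  refine ⟨Realification.ofHom
    { toFun := fun f => Multiplicative.ofAdd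
        (Multiplicative.toAdd (s'.toHom f) - Multiplicative.toAdd (s.toHom f))
      map_one' := by rw [map_one s'.toHom, map_one s.toHom, toAdd_one, tsub_zero, ofAdd_zero]
      map_mul' := fun f g => ?_ }, ?_⟩
  · rw [← ofAdd_add]
    congr 1
    rw [map_mul s'.toHom, map_mul s.toHom, toAdd_mul, toAdd_mul]
    apply tsub_eq_of_eq_add
    calc Multiplicative.toAdd (s'.toHom f) + Multiplicative.toAdd (s'.toHom g)
        = (Multiplicative.toAdd (s'.toHom f) - Multiplicative.toAdd (s.toHom f)
            + Multiplicative.toAdd (s.toHom f))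
          + (Multiplicative.toAdd (s'.toHom g) - Multiplicative.toAdd (s.toHom g)
            + Multiplicative.toAdd (s.toHom g)) := by
          rw [tsub_add_cancel_of_le (h f), tsub_add_cancel_of_le (h g)]
      _ = _ := by
          rw [add_add_add_comm]
  · refine Realification.ext' fun f => Multiplicative.toAdd.injective ?_
    simp only [Realification.toHom_mul, MonoidHom.mul_apply, toAdd_mul, Realification.toHom_ofHom,
      MonoidHom.coe_mk, OneHom.coe_mk, toAdd_ofAdd, add_tsub_cancel_of_le (h f)]

/-- **The order of `N ⊗ ℝ_{≥0}` is pointwise**: `s ∣ s'` iff `s(f) ≤ s'(f)` for every `f ∈ N^∨`.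
[cite: MochizukiFrdI2008, §0 p.10] -/
theorem Realification.dvd_iff_apply_le (s s' : Realification N) :
    s ∣ s' ↔ ∀ f, Multiplicative.toAdd (s.toHom f) ≤ Multiplicative.toAdd (s'.toHom f) :=
  ⟨fun h f => Realification.apply_le_of_dvd h f, Realification.dvd_of_apply_le⟩

end RealificationOrder

/-! ### The powers `s^r`, `r ∈ ℝ_{≥0}`, on `N ⊗ ℝ_{≥0}` -/

section RealificationRPow

variable {N : Type u} [CommMonoid N]

/-- **The power `s ↦ s^r` on `N ⊗ ℝ_{≥0}`** for `r ∈ ℝ_{≥0}`: multiply every value of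
`s : Hom(N^∨, ℝ_{≥0})` by `r` (the `ℝ_{≥0}`-semimodule structure of the completion `M ⊗ ℝ_{≥0}` of §0
p. 10, written multiplicatively); a monoid endomorphism. [cite: MochizukiFrdI2008, §0 p.10] -/
def Realification.rpow (r : NNReal) : Realification N →* Realification N where
  toFun s := Realification.ofHom
    { toFun := fun f => Multiplicative.ofAdd (r * Multiplicative.toAdd (s.toHom f))
      map_one' := by rw [map_one s.toHom, toAdd_one, mul_zero, ofAdd_zero]
      map_mul' := fun f g => by rw [map_mul s.toHom, toAdd_mul, mul_add, ofAdd_add] }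
  map_one' := Realification.ext' fun f => by
    simp only [Realification.toHom_ofHom, MonoidHom.coe_mk, OneHom.coe_mk, Realification.toHom_one,
      MonoidHom.one_apply, toAdd_one, mul_zero, ofAdd_zero]
  map_mul' s t := Realification.ext' fun f => by
    simp only [Realification.toHom_ofHom, MonoidHom.coe_mk, OneHom.coe_mk, Realification.toHom_mul,
      MonoidHom.mul_apply, toAdd_mul, mul_add, ofAdd_add]

/-- The values of `s^r`: `(s^r)(f) = r · s(f)`. [cite: MochizukiFrdI2008, §0 p.10] -/
theorem Realification.toHom_rpow (r : NNReal) (s : Realification N) (f : RDual N) :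
    (Realification.rpow r s).toHom f = Multiplicative.ofAdd (r * Multiplicative.toAdd (s.toHom f)) :=
  rfl

/-- The values of `s^r`, additively. [cite: MochizukiFrdI2008, §0 p.10] -/
@[simp] theorem Realification.toAdd_toHom_rpow (r : NNReal) (s : Realification N) (f : RDual N) :
    Multiplicative.toAdd ((Realification.rpow r s).toHom f) = r * Multiplicative.toAdd (s.toHom f) :=
  rfl

/-- `s^0 = 1`. [cite: MochizukiFrdI2008, §0 p.10] -/
@[simp] theorem Realification.rpow_zero (s : Realification N) : Realification.rpow 0 s = 1 :=
  Realification.ext' fun f => by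
    rw [Realification.toHom_rpow, zero_mul, ofAdd_zero, Realification.toHom_one, MonoidHom.one_apply]

/-- `s^1 = s`. [cite: MochizukiFrdI2008, §0 p.10] -/
@[simp] theorem Realification.rpow_one (s : Realification N) : Realification.rpow 1 s = s :=
  Realification.ext' fun f => by rw [Realification.toHom_rpow, one_mul, ofAdd_toAdd]

/-- `s^{r+r'} = s^r · s^{r'}`. [cite: MochizukiFrdI2008, §0 p.10] -/
theorem Realification.rpow_add (r r' : NNReal) (s : Realification N) :
    Realification.rpow (r + r') s = Realification.rpow r s * Realification.rpow r' s :=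
  Realification.ext' fun f => by
    rw [Realification.toHom_mul, MonoidHom.mul_apply, Realification.toHom_rpow,
      Realification.toHom_rpow, Realification.toHom_rpow, add_mul, ofAdd_add]

/-- `s^{r r'} = (s^{r'})^r`. [cite: MochizukiFrdI2008, §0 p.10] -/
theorem Realification.rpow_mul (r r' : NNReal) (s : Realification N) :
    Realification.rpow (r * r') s = Realification.rpow r (Realification.rpow r' s) :=
  Realification.ext' fun f => by
    rw [Realification.toHom_rpow, Realification.toHom_rpow, Realification.toHom_rpow, toAdd_ofAdd,
      mul_assoc]

/-- The powers commute: `(s^{r'})^r = (s^r)^{r'}`. [cite: MochizukiFrdI2008, §0 p.10] -/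
theorem Realification.rpow_comm (r r' : NNReal) (s : Realification N) :
    Realification.rpow r (Realification.rpow r' s) = Realification.rpow r' (Realification.rpow r s) := by
  rw [← Realification.rpow_mul, mul_comm, Realification.rpow_mul]

/-- `s^n` for `n ∈ ℕ ⊆ ℝ_{≥0}` is the `n`-th power. [cite: MochizukiFrdI2008, §0 p.10] -/
theorem Realification.rpow_natCast (n : ℕ) (s : Realification N) :
    Realification.rpow (n : NNReal) s = s ^ n :=
  Realification.ext' fun f => by
    rw [Realification.toHom_rpow, Realification.toHom_pow, MonoidHom.pow_apply, ← nsmul_eq_mul,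
      ofAdd_nsmul, ofAdd_toAdd]

/-- The `n`-th root of `RealificationRoots.lean` is the power `s^{1/n}`. [cite: MochizukiFrdI2008, §0 p.10] -/
theorem Realification.root_eq_rpow (n : ℕ+) (s : Realification N) :
    Realification.root n s = Realification.rpow ((n : ℕ) : NNReal)⁻¹ s :=
  Realification.ext' fun f => by
    rw [Realification.toHom_root, Realification.toHom_rpow, div_eq_inv_mul]

/-- `(s^{1/n})^n = s` in the form `rpow n (rpow n⁻¹ s) = s`. [cite: MochizukiFrdI2008, §0 p.10] -/
theorem Realification.rpow_natCast_rpow_inv {n : ℕ} (hn : 0 < n) (s : Realification N) :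
    Realification.rpow (n : NNReal) (Realification.rpow ((n : ℕ) : NNReal)⁻¹ s) = s := by
  have hn' : ((n : ℕ) : NNReal) ≠ 0 := Nat.cast_ne_zero.mpr hn.ne'
  rw [← Realification.rpow_mul, mul_inv_cancel₀ hn', Realification.rpow_one]

/-- `s^r = 1` iff `r = 0` or `s = 1` (`ℝ_{≥0}` has no zero divisors). [cite: MochizukiFrdI2008, §0 p.10] -/
theorem Realification.rpow_eq_one_iff (r : NNReal) (s : Realification N) :
    Realification.rpow r s = 1 ↔ r = 0 ∨ s = 1 := by
  constructor
  · intro h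
    by_cases hr : r = 0
    · exact Or.inl hr
    · refine Or.inr (Realification.ext' fun f => ?_)
      have h1 := DFunLike.congr_fun (congrArg Realification.toHom h) f
      rw [Realification.toHom_rpow, Realification.toHom_one, MonoidHom.one_apply, ← ofAdd_zero] at h1
      have h2 := Multiplicative.ofAdd.injective h1
      rw [mul_eq_zero] at h2
      rw [Realification.toHom_one, MonoidHom.one_apply, ← ofAdd_toAdd (s.toHom f), h2.resolve_left hr,
        ofAdd_zero]
  · rintro (rfl | rfl)
    · exact Realification.rpow_zero s
    · exact map_one _

/-- For `r ≠ 0` the power `s ↦ s^r` is injective (its inverse is `s ↦ s^{1/r}`).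
[cite: MochizukiFrdI2008, §0 p.10] -/
theorem Realification.rpow_injective {r : NNReal} (hr : r ≠ 0) :
    Injective (Realification.rpow (N := N) r) := by
  intro s t hst
  have h := congrArg (Realification.rpow r⁻¹) hst
  rwa [← Realification.rpow_mul, ← Realification.rpow_mul, inv_mul_cancel₀ hr, Realification.rpow_one,
    Realification.rpow_one] at h

/-- Functoriality: `(N ⊗ ℝ_{≥0} → N' ⊗ ℝ_{≥0})` induced by `φ : N → N'` commutes with the powers.
[cite: MochizukiFrdI2008, §0 p.10] -/
theorem Realification.map_rpow {N' : Type u} [CommMonoid N'] (φ : N →* N') (r : NNReal)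
    (s : Realification N) :
    Realification.map φ (Realification.rpow r s) = Realification.rpow r (Realification.map φ s) :=
  rfl

/-- The powers are monotone in the base: `s ∣ t ⇒ s^r ∣ t^r`. [cite: MochizukiFrdI2008, §0 p.10] -/
theorem Realification.rpow_dvd_rpow {s t : Realification N} (h : s ∣ t) (r : NNReal) :
    Realification.rpow r s ∣ Realification.rpow r t :=
  map_dvd _ h

/-- For `r ≠ 0`: `s^r ∣ t^r` iff `s ∣ t`. [cite: MochizukiFrdI2008, §0 p.10] -/
theorem Realification.rpow_dvd_rpow_iff {r : NNReal} (hr : r ≠ 0) (s t : Realification N) :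
    Realification.rpow r s ∣ Realification.rpow r t ↔ s ∣ t := by
  refine ⟨fun h => ?_, fun h => Realification.rpow_dvd_rpow h r⟩
  have h' := Realification.rpow_dvd_rpow h r⁻¹
  rwa [← Realification.rpow_mul, ← Realification.rpow_mul, inv_mul_cancel₀ hr, Realification.rpow_one,
    Realification.rpow_one] at h'

/-- The powers are monotone in the exponent: `r ≤ r' ⇒ s^r ∣ s^{r'}`. [cite: MochizukiFrdI2008, §0 p.10] -/
theorem Realification.rpow_dvd_rpow_of_le {r r' : NNReal} (h : r ≤ r') (s : Realification N) :
    Realification.rpow r s ∣ Realification.rpow r' s := by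
  obtain ⟨d, rfl⟩ := exists_add_of_le h
  rw [Realification.rpow_add]
  exact dvd_mul_right _ _

end RealificationRPow

/-! ### Componentwise powers on `M^rlf_factor = ∏_𝔮 M^rlf_𝔮` -/

section RlfFactorRPow

variable {M : Type u} [CommMonoid M]

/-- The componentwise power `a ↦ a^r` on `M^rlf_factor = ∏_𝔮 M^pf_𝔮 ⊗ ℝ_{≥0}`.
[cite: MochizukiFrdI2008, Def. 2.4(i) p.48] -/
def RlfFactor.rpow (r : NNReal) : RlfFactor M →* RlfFactor M where
  toFun a 𝔮 := Realification.rpow r (a 𝔮)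
  map_one' := funext fun 𝔮 => by simp only [Pi.one_apply, map_one]
  map_mul' a b := funext fun 𝔮 => by simp only [Pi.mul_apply, map_mul]

/-- Components of `a^r`. [cite: MochizukiFrdI2008, Def. 2.4(i) p.48] -/
@[simp] theorem RlfFactor.rpow_apply (r : NNReal) (a : RlfFactor M) (𝔮 : Primes (Perfection M)) :
    RlfFactor.rpow r a 𝔮 = Realification.rpow r (a 𝔮) := rfl

/-- `Supp(a^r) ⊆ Supp(a)`. [cite: MochizukiFrdI2008, Def. 2.4(i) p.48] -/
theorem supp_rpow_subset (r : NNReal) (a : RlfFactor M) : supp (RlfFactor.rpow r a) ⊆ supp a := by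
  intro 𝔮 h𝔮 h
  exact h𝔮 (by rw [RlfFactor.rpow_apply, h, map_one])

/-- `Supp(a^r) = Supp(a)` for `r ≠ 0`. [cite: MochizukiFrdI2008, Def. 2.4(i) p.48] -/
theorem supp_rpow {r : NNReal} (hr : r ≠ 0) (a : RlfFactor M) : supp (RlfFactor.rpow r a) = supp a := by
  ext 𝔮
  simp only [supp, Set.mem_setOf_eq, RlfFactor.rpow_apply, ne_eq, Realification.rpow_eq_one_iff, hr,
    false_or]

/-- `a^0 = 1` on `M^rlf_factor`. [cite: MochizukiFrdI2008, Def. 2.4(i) p.48] -/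
@[simp] theorem RlfFactor.rpow_zero (a : RlfFactor M) : RlfFactor.rpow 0 a = 1 :=
  funext fun 𝔮 => by rw [RlfFactor.rpow_apply, Realification.rpow_zero, Pi.one_apply]

/-- `a^1 = a` on `M^rlf_factor`. [cite: MochizukiFrdI2008, Def. 2.4(i) p.48] -/
@[simp] theorem RlfFactor.rpow_one (a : RlfFactor M) : RlfFactor.rpow 1 a = a :=
  funext fun 𝔮 => by rw [RlfFactor.rpow_apply, Realification.rpow_one]

/-- `a^{r+r'} = a^r · a^{r'}` on `M^rlf_factor`. [cite: MochizukiFrdI2008, Def. 2.4(i) p.48] -/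
theorem RlfFactor.rpow_add (r r' : NNReal) (a : RlfFactor M) :
    RlfFactor.rpow (r + r') a = RlfFactor.rpow r a * RlfFactor.rpow r' a :=
  funext fun 𝔮 => by rw [Pi.mul_apply, RlfFactor.rpow_apply, RlfFactor.rpow_apply, RlfFactor.rpow_apply,
    Realification.rpow_add]

/-- `a^{r r'} = (a^{r'})^r` on `M^rlf_factor`. [cite: MochizukiFrdI2008, Def. 2.4(i) p.48] -/
theorem RlfFactor.rpow_mul (r r' : NNReal) (a : RlfFactor M) :
    RlfFactor.rpow (r * r') a = RlfFactor.rpow r (RlfFactor.rpow r' a) :=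
  funext fun 𝔮 => by rw [RlfFactor.rpow_apply, RlfFactor.rpow_apply, RlfFactor.rpow_apply,
    Realification.rpow_mul]

/-- `a^n` for `n ∈ ℕ` is the `n`-th power on `M^rlf_factor`. [cite: MochizukiFrdI2008, Def. 2.4(i) p.48] -/
theorem RlfFactor.rpow_natCast (n : ℕ) (a : RlfFactor M) : RlfFactor.rpow (n : NNReal) a = a ^ n :=
  funext fun 𝔮 => by rw [RlfFactor.rpow_apply, Realification.rpow_natCast, Pi.pow_apply]

end RlfFactorRPow

/-! ### The powers `a^r` on the realification `M^rlf` of a perf-factorial monoid -/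

namespace IsPerfFactorial

variable {M : Type u} [CommMonoid M] (h : IsPerfFactorial M)

/-- `M^rlf ⊆ M^rlf_factor` is stable under the powers `a ↦ a^r` (supports are preserved).
[cite: MochizukiFrdI2008, Def. 2.4(i) p.48] -/
theorem rpow_mem (r : NNReal) (a : h.Rlf) : RlfFactor.rpow r (a : RlfFactor M) ∈ h.realification := by
  obtain ⟨b, hb⟩ := a.2
  exact ⟨b, (supp_rpow_subset r _).trans hb⟩

namespace Rlf

/-- **The power `a ↦ a^r` on `M^rlf`**, `r ∈ ℝ_{≥0}`: the `ℝ_{≥0}`-semimodule structure of the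
realification whose groupification is the `ℝ`-vector space `(M^rlf)^gp` of Def. 2.4 (i) p. 48.
[cite: MochizukiFrdI2008, Def. 2.4(i) p.48] -/
def rpow (r : NNReal) : h.Rlf →* h.Rlf :=
  ((RlfFactor.rpow r).comp h.realification.subtype).codRestrict _ fun a => h.rpow_mem r a

/-- Components of `a^r` in `M^rlf`. [cite: MochizukiFrdI2008, Def. 2.4(i) p.48] -/
@[simp] theorem coe_rpow (r : NNReal) (a : h.Rlf) :
    ((rpow h r a : h.Rlf) : RlfFactor M) = RlfFactor.rpow r (a : RlfFactor M) := rfl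

/-- `a^0 = 1` in `M^rlf`. [cite: MochizukiFrdI2008, Def. 2.4(i) p.48] -/
@[simp] theorem rpow_zero (a : h.Rlf) : rpow h 0 a = 1 :=
  Subtype.ext (by rw [coe_rpow, RlfFactor.rpow_zero, coe_one])

/-- `a^1 = a` in `M^rlf`. [cite: MochizukiFrdI2008, Def. 2.4(i) p.48] -/
@[simp] theorem rpow_one (a : h.Rlf) : rpow h 1 a = a :=
  Subtype.ext (by rw [coe_rpow, RlfFactor.rpow_one])

/-- `a^{r+r'} = a^r · a^{r'}` in `M^rlf`. [cite: MochizukiFrdI2008, Def. 2.4(i) p.48] -/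
theorem rpow_add (r r' : NNReal) (a : h.Rlf) : rpow h (r + r') a = rpow h r a * rpow h r' a :=
  Subtype.ext (by rw [coe_rpow, coe_mul, coe_rpow, coe_rpow, RlfFactor.rpow_add])

/-- `a^{r r'} = (a^{r'})^r` in `M^rlf`. [cite: MochizukiFrdI2008, Def. 2.4(i) p.48] -/
theorem rpow_mul (r r' : NNReal) (a : h.Rlf) : rpow h (r * r') a = rpow h r (rpow h r' a) :=
  Subtype.ext (by rw [coe_rpow, coe_rpow, coe_rpow, RlfFactor.rpow_mul])

/-- The powers commute in `M^rlf`. [cite: MochizukiFrdI2008, Def. 2.4(i) p.48] -/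
theorem rpow_comm (r r' : NNReal) (a : h.Rlf) : rpow h r (rpow h r' a) = rpow h r' (rpow h r a) := by
  rw [← rpow_mul, mul_comm, rpow_mul]

/-- `a^n`, `n ∈ ℕ`, is the `n`-th power in `M^rlf`. [cite: MochizukiFrdI2008, Def. 2.4(i) p.48] -/
theorem rpow_natCast (n : ℕ) (a : h.Rlf) : rpow h (n : NNReal) a = a ^ n :=
  Subtype.ext (by rw [coe_rpow, coe_pow, RlfFactor.rpow_natCast])

/-- `(a^{1/n})^n = a` in `M^rlf`: the `n`-th root of `RlfStructure.lean` is `a^{1/n}`.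
[cite: MochizukiFrdI2008, Def. 2.4(i) p.48] -/
theorem root_eq_rpow (n : ℕ+) (a : h.Rlf) : root h n a = rpow h ((n : ℕ) : NNReal)⁻¹ a :=
  Subtype.ext (funext fun 𝔮 => by
    rw [coe_rpow, RlfFactor.rpow_apply, ← Realification.root_eq_rpow]; rfl)

/-- For `r ≠ 0`, `a ↦ a^r` is injective on `M^rlf`. [cite: MochizukiFrdI2008, Def. 2.4(i) p.48] -/
theorem rpow_injective {r : NNReal} (hr : r ≠ 0) : Injective (rpow h r) := by
  intro a b hab
  have h' := congrArg (rpow h r⁻¹) hab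
  rwa [← rpow_mul, ← rpow_mul, inv_mul_cancel₀ hr, rpow_one, rpow_one] at h'

/-- `a^r = 1` in `M^rlf` iff `r = 0` or `a = 1`. [cite: MochizukiFrdI2008, Def. 2.4(i) p.48] -/
theorem rpow_eq_one_iff (r : NNReal) (a : h.Rlf) : rpow h r a = 1 ↔ r = 0 ∨ a = 1 := by
  by_cases hr : r = 0
  · subst hr
    simp only [rpow_zero, true_or]
  · simp only [hr, false_or]
    constructor
    · intro h1
      exact rpow_injective h hr (by rw [h1, map_one])
    · rintro rfl
      exact map_one _

/-- The powers are monotone in the exponent on `M^rlf`: `r ≤ r' ⇒ a^r ∣ a^{r'}`.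
[cite: MochizukiFrdI2008, Def. 2.4(i) p.48] -/
theorem rpow_dvd_rpow_of_le {r r' : NNReal} (hrr' : r ≤ r') (a : h.Rlf) : rpow h r a ∣ rpow h r' a := by
  obtain ⟨d, rfl⟩ := exists_add_of_le hrr'
  rw [rpow_add]
  exact dvd_mul_right _ _

/-- For `r ≠ 0`: `a^r ∣ b^r` in `M^rlf` iff `a ∣ b`. [cite: MochizukiFrdI2008, Def. 2.4(i) p.48] -/
theorem rpow_dvd_rpow_iff {r : NNReal} (hr : r ≠ 0) (a b : h.Rlf) : rpow h r a ∣ rpow h r b ↔ a ∣ b := by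
  refine ⟨fun hab => ?_, fun hab => map_dvd _ hab⟩
  have h' := map_dvd (rpow h r⁻¹) hab
  rwa [← rpow_mul, ← rpow_mul, inv_mul_cancel₀ hr, rpow_one, rpow_one] at h'

/-- The order of `M^rlf` read on values: `a ∣ b` iff `a_𝔮(f) ≤ b_𝔮(f)` for every prime `𝔮` and every
`f ∈ (M^pf_𝔮)^∨` (componentwise order, `Rlf.dvd_iff`, and the pointwise order of each `M^rlf_𝔮`).
[cite: MochizukiFrdI2008, Def. 2.4(i) p.48] -/
theorem dvd_iff_apply_le (a b : h.Rlf) :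
    a ∣ b ↔ ∀ 𝔮 f, Multiplicative.toAdd (((a : RlfFactor M) 𝔮).toHom f) ≤
      Multiplicative.toAdd (((b : RlfFactor M) 𝔮).toHom f) := by
  rw [dvd_iff]
  exact forall_congr' fun 𝔮 => Realification.dvd_iff_apply_le _ _

end Rlf

end IsPerfFactorial

end Literature.AlgebraicGeometry.Frobenioids
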